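import Summits.CriticalPhenomena.CardyFormulaZ2.Theorems.CardyComplexConeParafermionToSLESixFamiliesFlipReturnLaw
import Summits.CriticalPhenomena.CardyFormulaZ2.Theorems.CardyComplexConeParafermionToSLESixFamiliesFlipStaggerInOut
import Summits.CriticalPhenomena.CardyFormulaZ2.Theorems.CardyComplexConeParafermionToSLESixFamiliesFaceKernelInnerNearCompact
import Summits.CriticalPhenomena.CardyFormulaZ2.Theorems.CardyComplexConeCoherentMoreraTraceIdentityAux
import HarnessLib

/-!
# S0 in tilt form: `TiltLawSummed → StaggerSummedVanishing` (and conversely)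
(line `flip-involution-return-law` of crux `CardyComplexCone.ParafermionToSLESixFamilies`, stmt-CriticalPhenomena-11389;
glue of the lead's cycle-2 reshape `stub_staggerSummed := stub_tiltLawSummed`)

For a family `Λ` with the crux's guards over a Dobrushin (hence Jordan) domain `D` and a compact `K ⊂ D`,
every lattice edge whose medial point lies in `K` is, for small mesh, an INTERIOR free edge: all faces at
its endpoints are inner (`FaceKernel.stub_isInnerFace_near_compact` applied to a compact thickening of `K`),
so the endpoints are off the discrete boundary, off both arcs, and the edge is not `e_a`, `e_b`. There the
landed return law (`stub_returnLaw`, `inOut_eq_tilt_form`) and the dart bookkeeping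
(`stagger_eq_signed_inOut`) give `stagger (Λ δ) δ (x,i) = ±((g(1) − g(−1))·Y₊ + ((1 − √3/2) + g(−1)/2)·S₁)`,
so the two `K`-sums of norms AGREE eventually in `δ`, and the summed staggered bound
`StaggerSummedVanishing` is equivalent to the summed phase-tilt law `TiltLawSummed`
(registered sub-goals `staggerSummedVanishing_of_tiltLawSummed`, `tiltLawSummed_of_staggerSummedVanishing`).
-/

noncomputable section

namespace Summit.CriticalPhenomena.CardyFormulaZ2.Cruxes.ParafermionToSLESixFamilies.FlipInvolutionReturnLaw

open MeasureTheory Filter Set Metric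
open scoped BigOperators Topology
open Literature.Probability Literature.Probability.LatticeModels Literature.Probability.Percolation
open Literature.Probability.RandomPlanarGeometry (DobrushinDomain)
open Literature.Barriers.CriticalPhenomena (medialVertexOf)
open Summit.CriticalPhenomena.CardyFormulaZ2.Cruxes.ParafermionToSLESixFamilies.IicTraceFluxPairing (stagger)
open Summit.CriticalPhenomena.CardyFormulaZ2.Cruxes.EdgePrecompact.QkzStripBoundaryArm (not_mem_zdBoundary_of_forall_isInnerFace)
open Summit.CriticalPhenomena.CardyFormulaZ2.Cruxes.ParafermionToSLESixFamilies.FaceKernel (stub_isInnerFace_near_compact)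
open Summit.CriticalPhenomena.CardyFormulaZ2.Cruxes.CoherentMorera.FinitaryGreenPairing.TraceIdentity (dist_meshPoint_medialPoint)
open Literature.Probability.LatticeModels.Mesh (cell)

/-- **Edges over a compact are interior for small mesh, and there the staggered mode is the tilt defect.**
For a family with the crux's guards over `D` and a compact `K ⊂ D`: eventually in `δ → 0⁺`, at every
lattice edge `z = s(x, x + eᵢ)` whose medial point lies in `K`,
`‖stagger (Λ δ) δ (x, i)‖ = ‖(g(1) − g(−1))·Yplus (Λ δ) z + ((1 − √3/2) + g(−1)/2)·S1 (Λ δ) z‖`. -/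
theorem eventually_norm_stagger_eq_norm_tilt (D : DobrushinDomain) (Λ : ℝ → DiscreteDobrushin)
    (hΩ : ∀ δ, (Λ δ).Ω = D.carrier) (hmesh : ∀ δ, (Λ δ).δ = δ) (hadm : ∀ᶠ δ in 𝓝[>] (0:ℝ), (Λ δ).IsZdAdmissible)
    {K : Set ℂ} (hK : IsCompact K) (hKD : K ⊆ D.carrier) :
    ∀ᶠ δ in 𝓝[>] (0:ℝ), ∀ p : Site 2 × Fin 2, medialPoint δ (medialVertexOf p) ∈ K →
      ‖stagger (Λ δ) δ p‖ = ‖(gTilt 1 - gTilt (-1)) * Yplus (Λ δ) (medialVertexOf p) +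
        ((1 - (Real.sqrt 3 : ℂ) / 2) + gTilt (-1) / 2) * S1 (Λ δ) (medialVertexOf p)‖ := by
  -- a compact thickening `K₁ ⊆ D` of `K` and the bulk threshold for it
  obtain ⟨ρ, hρ, hρK⟩ := hK.exists_cthickening_subset_open D.isOpen hKD
  obtain ⟨δ₀, hδ₀, hinner⟩ := stub_isInnerFace_near_compact D.toJordanDomain (cthickening ρ K) (hK.cthickening) hρK
  have hsmall : ∀ᶠ δ in 𝓝[>] (0:ℝ), 0 < δ ∧ δ < min δ₀ ρ := by
    have h1 : ∀ᶠ δ in 𝓝[>] (0:ℝ), δ ∈ Ioo (0:ℝ) (min δ₀ ρ) := Ioo_mem_nhdsGT (lt_min hδ₀ hρ)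
    exact h1.mono fun δ hδ => hδ
  filter_upwards [hadm, hsmall] with δ hE hδ p hpK
  obtain ⟨hδpos, hδlt⟩ := hδ
  have hδ₀' : δ < δ₀ := hδlt.trans_le (min_le_left _ _)
  have hδρ : δ ≤ ρ := (hδlt.trans_le (min_le_right _ _)).le
  set E := Λ δ with hEdef
  have hEδ : E.δ = δ := hmesh δ
  obtain ⟨x, i⟩ := p
  -- both endpoints have all four faces inner
  have hend : ∀ x' ∈ medialVertexOf (x, i), ∀ j : Fin 4, E.IsInnerFace (faceAt x' j) := by
    intro x' hx' j
    have hdist : dist (meshPoint δ x') (medialPoint δ (medialVertexOf (x, i))) = δ / 2 :=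
      dist_meshPoint_medialPoint hδpos.le hx'
    have hxK₁ : meshPoint δ x' ∈ cthickening ρ K :=
      mem_cthickening_of_dist_le _ _ _ _ hpK (by rw [hdist]; linarith)
    have hcell : meshPoint E.δ x' ∈ closure (cell E.δ ((faceAt x' j) 0) ((faceAt x' j) 1)) :=
      meshPoint_mem_closure_cell_of_isCorner (by rw [hEδ]; exact hδpos) (isCorner_faceAt x' j)
    rw [hEδ] at hcell
    exact hinner E (hΩ δ) (by rw [hEδ]; exact hδpos) (by rw [hEδ]; exact hδ₀') (faceAt x' j) (meshPoint δ x') hxK₁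
      (by rw [hEδ]; exact hcell)
  have hxin := hend x (Sym2.mem_mk_left _ _)
  have hyin := hend (x + Pi.single i 1) (Sym2.mem_mk_right _ _)
  have hxb : x ∉ E.zdBoundary := not_mem_zdBoundary_of_forall_isInnerFace hxin
  have hyb : x + Pi.single i 1 ∉ E.zdBoundary := not_mem_zdBoundary_of_forall_isInnerFace hyin
  have hzi : ∀ y ∈ medialVertexOf (x, i), y ∉ E.zdArcA ∧ y ∉ E.zdArcB := by
    intro y hy
    rcases Sym2.mem_iff.1 hy with rfl | rfl
    · exact ⟨fun h => hxb (E.zdArcA_subset_zdBoundary h), fun h => hxb (E.zdArcB_subset_zdBoundary h)⟩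
    · exact ⟨fun h => hyb (E.zdArcA_subset_zdBoundary h), fun h => hyb (E.zdArcB_subset_zdBoundary h)⟩
  have hz : medialVertexOf (x, i) ∈ (discreteDomainGraph E.Ω E.δ).edgeSet := by
    have hk : ∃ k : Fin 4, cornerUnit k = Pi.single i 1 := by
      fin_cases i
      · exact ⟨0, rfl⟩
      · exact ⟨1, rfl⟩
    obtain ⟨k, hk⟩ := hk
    rw [medialVertexOf, SimpleGraph.mem_edgeSet, show (x, i).1 + Pi.single (x, i).2 1 = x + cornerUnit k by rw [hk]]
    exact DiscreteDobrushin.adj_of_isInnerFace_faceAt (hxin k) (Or.inl rfl)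
  have hzAB : medialVertexOf (x, i) ∉ E.zdABEdges := by
    rintro ⟨-, ⟨y, hy, hyA⟩, -⟩
    exact (hzi y hy).1 hyA
  -- the staggered mode is the signed tilt defect
  have hst := stagger_eq_signed_inOut E hE (x, i) hzAB
  rw [hEδ] at hst
  rw [hst, inOut_eq_tilt_form stub_returnLaw (hΩ δ) hE hz hzi, norm_mul]
  have hsgn : ‖(if (x, i).2 = 0 then -1 else 1 : ℂ)‖ = 1 := by split_ifs <;> simp
  rw [hsgn, one_mul]

/-- **S0 in tilt form ⇒ S0** (registered sub-goal `staggerSummedVanishing_of_tiltLawSummed` of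
stmt-CriticalPhenomena-11389, line `flip-involution-return-law`; the glue of the reshape
`stub_staggerSummed := stub_tiltLawSummed`). -/
theorem staggerSummedVanishing_of_tiltLawSummed : TiltLawSummed → StaggerSummedVanishing := by
  intro hT D Λ hΩ hmesh hadm K hK hKD
  refine (hT D Λ hΩ hmesh hadm K hK hKD).congr' ?_
  filter_upwards [eventually_norm_stagger_eq_norm_tilt D Λ hΩ hmesh hadm hK hKD] with δ hδ
  congr 1
  refine finsum_congr fun p => ?_
  by_cases hp : medialPoint δ (medialVertexOf p) ∈ K
  · rw [indicator_of_mem hp, indicator_of_mem hp, hδ p hp]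
  · rw [indicator_of_notMem hp, indicator_of_notMem hp]

/-- **S0 ⇒ S0 in tilt form** (registered sub-goal `tiltLawSummed_of_staggerSummedVanishing`): the converse,
so that the reshape loses nothing. -/
theorem tiltLawSummed_of_staggerSummedVanishing : StaggerSummedVanishing → TiltLawSummed := by
  intro hS D Λ hΩ hmesh hadm K hK hKD
  refine (hS D Λ hΩ hmesh hadm K hK hKD).congr' ?_
  filter_upwards [eventually_norm_stagger_eq_norm_tilt D Λ hΩ hmesh hadm hK hKD] with δ hδ
  congr 1
  refine finsum_congr fun p => ?_
  by_cases hp : medialPoint δ (medialVertexOf p) ∈ K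
  · rw [indicator_of_mem hp, indicator_of_mem hp, hδ p hp]
  · rw [indicator_of_notMem hp, indicator_of_notMem hp]

end Summit.CriticalPhenomena.CardyFormulaZ2.Cruxes.ParafermionToSLESixFamilies.FlipInvolutionReturnLaw

end
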